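import Mathlib
import HarnessLib
import Summits.HubbardSuperconductivity.HubbardSuperconductivity.Theorems.KLProgrammeKLRegimeVolumeLimitSitePeriodisationOnly
import Summits.HubbardSuperconductivity.HubbardSuperconductivity.Theorems.KLProgrammeKLRegimeSplitBundleV16
import Summits.HubbardSuperconductivity.HubbardSuperconductivity.Theses.KLProgramme

/-!
# Gen-6 VL child `KLRegimeVolumeLimitV16` (stmt-HubbardSuperconductivity-20239, bundle `klPredsV16`): the ROUTE DECL from each of the five
# modulus-free nested exports — by-`--workitem` closers for the engine lineage (seat hubbard-kl-k3c5-p3 g6, VL co-registrant)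

Route `KLProgramme`, crux K3 `KLRegimeTwoPointLimit` (stmt-…-19937), gen-6 child `…Theses.KLProgramme.KLRegimeVolumeLimitV16 :=
VolumeLimitP2 klPredsV16 FinalTwoLegVolLimitEx klWindowC` (registered skeleton «cauchy v5» 64369ff1b68a3526, one stub; «cauchy v6» cd1a43ed7d9c9a49 = the
nested-only stub, pending the pen's GO).  Whatever the registered stub text, the item CLOSES (`--workitem stmt-…-20239`) from ANY ONE of the following
engine exports at `(klPredsV16, klWindowC)`, with no modulus, no site moments and no frame-class hypothesis (the bound, six-bound and modulus texts are
landed theorems for every bundle: p504194, p512141, p513112):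

* `KLRegimeVolumeLimitV16_of_nestedText` — (N) nested same-point same-cutoff comparability of the BARE last-scale self-energy;
* `KLRegimeVolumeLimitV16_of_framedNestedText` — the same in the engine's own frame `K` of the binders;
* `KLRegimeVolumeLimitV16_of_perLabelThresholdsText` — bare (N) one Matsubara integer at a time, label-dependent rate AND threshold;
* `KLRegimeVolumeLimitV16_of_sitePeriodisationText` / `_of_framedSitePeriodisationText` — position space: the site kernel against the periodised site kernel
  of the nested volume `b·L` (bare / framed).

`klPredsV16.frameOK ⇒ FrameOK` is `klPredsV16_frameOK_imp` (…SplitBundleV16).  Everything is proved; no definition.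
-/

noncomputable section

namespace Summit.HubbardSuperconductivity.HubbardSuperconductivity.Theorems.TwoPointAssembly

set_option linter.dupNamespace false -- summit = problem name (single-conjunct summit), D-0017

open Finset Filter Topology Literature.MathematicalPhysics.QuantumLattice Literature.Probability.LatticeModels
open Literature.MathematicalPhysics.QuantumLattice.FermiRG
open Summit.HubbardSuperconductivity.HubbardSuperconductivity.Theorems.DispersionFlow
open Summit.HubbardSuperconductivity.HubbardSuperconductivity.Theorems.KLRegimeSplit
open Summit.HubbardSuperconductivity.HubbardSuperconductivity.Theorems.KLProgrammeLegKernels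

/-- **The gen-6 VL child from the BARE NESTED export (N) alone.** -/
theorem KLRegimeVolumeLimitV16_of_nestedText
    (hN : ∀ (G : GeoConsts) (P : SplitConsts) (Q : EngConsts) (R : RenConsts), G.WF → P.WF → Q.WF → R.WF →
      ∃ c₅ : ℝ, 0 < c₅ ∧ ∀ c : ℝ, 0 < c → c ≤ c₅ → ∃ U₀ : ℝ, 0 < U₀ ∧
        ∀ μ ∈ klWindowC, ∀ U : ℝ, 0 < U → U ≤ U₀ → ∀ β : ℝ, klBetaMin ≤ β → β ≤ Real.exp (c / U ^ 2) →
          ∀ K : TrigPolyC4v, klPredsV16.frameOK R U (nScales β) μ K →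
            ∀ (Lstar : ℕ) (Mstar : ℕ → ℕ), TowerP klPredsV16 G P Q R β U μ K Lstar Mstar →
              ∃ L₀ : ℕ, ∃ ρ : ℕ → ℝ, Tendsto ρ atTop (𝓝 0) ∧
                ∀ (L : ℕ) [NeZero L], L₀ ≤ L → ∀ (L'' : ℕ) [NeZero L''], L ∣ L'' → ∃ M₀ : ℕ, ∀ (M : ℕ) [NeZero M], M₀ ≤ M →
                  ∀ (ω : MatsubaraIdx M) (k : TorusSite 2 L) (k'' : TorusSite 2 L''), latticeMomentum L'' k'' = latticeMomentum L k →
                    ‖klSelfEnergy L M β U μ 0 klE0 (nScales β + 1) (ω, k) 0 -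
                        klSelfEnergy L'' M β U μ 0 klE0 (nScales β + 1) (ω, k'') 0‖ ≤ ρ L) :
    Summit.HubbardSuperconductivity.HubbardSuperconductivity.Theses.KLProgramme.KLRegimeVolumeLimitV16 := by
  show VolumeLimitP2 klPredsV16 FinalTwoLegVolLimitEx klWindowC
  exact volumeLimitP2_of_nestedOnlyText klPredsV16 klWindowC klPredsV16_frameOK_imp hN

/-- **The gen-6 VL child from the FRAMED NESTED export alone** (the engine's own frame `K`). -/
theorem KLRegimeVolumeLimitV16_of_framedNestedText
    (hN : ∀ (G : GeoConsts) (P : SplitConsts) (Q : EngConsts) (R : RenConsts), G.WF → P.WF → Q.WF → R.WF →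
      ∃ c₅ : ℝ, 0 < c₅ ∧ ∀ c : ℝ, 0 < c → c ≤ c₅ → ∃ U₀ : ℝ, 0 < U₀ ∧
        ∀ μ ∈ klWindowC, ∀ U : ℝ, 0 < U → U ≤ U₀ → ∀ β : ℝ, klBetaMin ≤ β → β ≤ Real.exp (c / U ^ 2) →
          ∀ K : TrigPolyC4v, klPredsV16.frameOK R U (nScales β) μ K →
            ∀ (Lstar : ℕ) (Mstar : ℕ → ℕ), TowerP klPredsV16 G P Q R β U μ K Lstar Mstar →
              ∃ L₀ : ℕ, ∃ ρ : ℕ → ℝ, Tendsto ρ atTop (𝓝 0) ∧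
                ∀ (L : ℕ) [NeZero L], L₀ ≤ L → ∀ (L'' : ℕ) [NeZero L''], L ∣ L'' → ∃ M₀ : ℕ, ∀ (M : ℕ) [NeZero M], M₀ ≤ M →
                  ∀ (ω : MatsubaraIdx M) (k : TorusSite 2 L) (k'' : TorusSite 2 L''), latticeMomentum L'' k'' = latticeMomentum L k →
                    ‖klSelfEnergy L M β U μ K klE0 (nScales β + 1) (ω, k) 0 -
                        klSelfEnergy L'' M β U μ K klE0 (nScales β + 1) (ω, k'') 0‖ ≤ ρ L) :
    Summit.HubbardSuperconductivity.HubbardSuperconductivity.Theses.KLProgramme.KLRegimeVolumeLimitV16 := by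
  show VolumeLimitP2 klPredsV16 FinalTwoLegVolLimitEx klWindowC
  exact volumeLimitP2_of_framedNestedOnlyText klPredsV16 klWindowC hN

/-- **The gen-6 VL child from the bare PER-LABEL nested export with label-dependent thresholds alone.** -/
theorem KLRegimeVolumeLimitV16_of_perLabelThresholdsText
    (hN : ∀ (G : GeoConsts) (P : SplitConsts) (Q : EngConsts) (R : RenConsts), G.WF → P.WF → Q.WF → R.WF →
      ∃ c₅ : ℝ, 0 < c₅ ∧ ∀ c : ℝ, 0 < c → c ≤ c₅ → ∃ U₀ : ℝ, 0 < U₀ ∧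
        ∀ μ ∈ klWindowC, ∀ U : ℝ, 0 < U → U ≤ U₀ → ∀ β : ℝ, klBetaMin ≤ β → β ≤ Real.exp (c / U ^ 2) →
          ∀ K : TrigPolyC4v, klPredsV16.frameOK R U (nScales β) μ K →
            ∀ (Lstar : ℕ) (Mstar : ℕ → ℕ), TowerP klPredsV16 G P Q R β U μ K Lstar Mstar →
              ∀ n : ℤ, ∃ L₀ : ℕ, ∃ ρ : ℕ → ℝ, Tendsto ρ atTop (𝓝 0) ∧
                ∀ (L : ℕ) [NeZero L], L₀ ≤ L → ∀ (L'' : ℕ) [NeZero L''], L ∣ L'' → ∃ M₀ : ℕ, ∀ (M : ℕ) [NeZero M], M₀ ≤ M →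
                  ∀ (ω : MatsubaraIdx M), matsubaraInt M ω = n → ∀ (k : TorusSite 2 L) (k'' : TorusSite 2 L''),
                    latticeMomentum L'' k'' = latticeMomentum L k →
                      ‖klSelfEnergy L M β U μ 0 klE0 (nScales β + 1) (ω, k) 0 -
                          klSelfEnergy L'' M β U μ 0 klE0 (nScales β + 1) (ω, k'') 0‖ ≤ ρ L) :
    Summit.HubbardSuperconductivity.HubbardSuperconductivity.Theses.KLProgramme.KLRegimeVolumeLimitV16 := by
  show VolumeLimitP2 klPredsV16 FinalTwoLegVolLimitEx klWindowC
  exact volumeLimitP2_of_perLabelThresholdsOnlyText klPredsV16 klWindowC klPredsV16_frameOK_imp hN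

/-- **The gen-6 VL child from the bare POSITION-SPACE nested export (S) alone.** -/
theorem KLRegimeVolumeLimitV16_of_sitePeriodisationText
    (hS : ∀ (G : GeoConsts) (P : SplitConsts) (Q : EngConsts) (R : RenConsts), G.WF → P.WF → Q.WF → R.WF →
      ∃ c₅ : ℝ, 0 < c₅ ∧ ∀ c : ℝ, 0 < c → c ≤ c₅ → ∃ U₀ : ℝ, 0 < U₀ ∧
        ∀ μ ∈ klWindowC, ∀ U : ℝ, 0 < U → U ≤ U₀ → ∀ β : ℝ, klBetaMin ≤ β → β ≤ Real.exp (c / U ^ 2) →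
          ∀ K : TrigPolyC4v, klPredsV16.frameOK R U (nScales β) μ K →
            ∀ (Lstar : ℕ) (Mstar : ℕ → ℕ), TowerP klPredsV16 G P Q R β U μ K Lstar Mstar →
              ∃ L₀ : ℕ, ∃ ρ : ℕ → ℝ, Tendsto ρ atTop (𝓝 0) ∧
                ∀ (L : ℕ) [NeZero L], L₀ ≤ L → ∀ (L'' : ℕ) [NeZero L''] (b : ℕ), L'' = b * L → ∃ M₀ : ℕ, ∀ (M : ℕ) [NeZero M], M₀ ≤ M →
                  ∀ ω : MatsubaraIdx M,
                    ∑ y : TorusSite 2 L,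
                      ‖torusFourierInv (fun k : TorusSite 2 L => klSelfEnergy L M β U μ 0 klE0 (nScales β + 1) (ω, k) 0) y -
                        ∑ x ∈ Finset.univ.filter (fun x : TorusSite 2 L'' => (fun i => (((x i).val : ℕ) : ZMod L)) = y),
                          torusFourierInv (fun k : TorusSite 2 L'' => klSelfEnergy L'' M β U μ 0 klE0 (nScales β + 1) (ω, k) 0) x‖ ≤ ρ L) :
    Summit.HubbardSuperconductivity.HubbardSuperconductivity.Theses.KLProgramme.KLRegimeVolumeLimitV16 := by
  show VolumeLimitP2 klPredsV16 FinalTwoLegVolLimitEx klWindowC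
  exact volumeLimitP2_of_sitePeriodisationOnlyText klPredsV16 klWindowC klPredsV16_frameOK_imp hS

/-- **The gen-6 VL child from the FRAMED POSITION-SPACE nested export alone.** -/
theorem KLRegimeVolumeLimitV16_of_framedSitePeriodisationText
    (hS : ∀ (G : GeoConsts) (P : SplitConsts) (Q : EngConsts) (R : RenConsts), G.WF → P.WF → Q.WF → R.WF →
      ∃ c₅ : ℝ, 0 < c₅ ∧ ∀ c : ℝ, 0 < c → c ≤ c₅ → ∃ U₀ : ℝ, 0 < U₀ ∧
        ∀ μ ∈ klWindowC, ∀ U : ℝ, 0 < U → U ≤ U₀ → ∀ β : ℝ, klBetaMin ≤ β → β ≤ Real.exp (c / U ^ 2) →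
          ∀ K : TrigPolyC4v, klPredsV16.frameOK R U (nScales β) μ K →
            ∀ (Lstar : ℕ) (Mstar : ℕ → ℕ), TowerP klPredsV16 G P Q R β U μ K Lstar Mstar →
              ∃ L₀ : ℕ, ∃ ρ : ℕ → ℝ, Tendsto ρ atTop (𝓝 0) ∧
                ∀ (L : ℕ) [NeZero L], L₀ ≤ L → ∀ (L'' : ℕ) [NeZero L''] (b : ℕ), L'' = b * L → ∃ M₀ : ℕ, ∀ (M : ℕ) [NeZero M], M₀ ≤ M →
                  ∀ ω : MatsubaraIdx M,
                    ∑ y : TorusSite 2 L,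
                      ‖torusFourierInv (fun k : TorusSite 2 L => klSelfEnergy L M β U μ K klE0 (nScales β + 1) (ω, k) 0) y -
                        ∑ x ∈ Finset.univ.filter (fun x : TorusSite 2 L'' => (fun i => (((x i).val : ℕ) : ZMod L)) = y),
                          torusFourierInv (fun k : TorusSite 2 L'' => klSelfEnergy L'' M β U μ K klE0 (nScales β + 1) (ω, k) 0) x‖ ≤ ρ L) :
    Summit.HubbardSuperconductivity.HubbardSuperconductivity.Theses.KLProgramme.KLRegimeVolumeLimitV16 := by
  show VolumeLimitP2 klPredsV16 FinalTwoLegVolLimitEx klWindowC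
  exact volumeLimitP2_of_framedSitePeriodisationOnlyText klPredsV16 klWindowC hS

end Summit.HubbardSuperconductivity.HubbardSuperconductivity.Theorems.TwoPointAssembly

end
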